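import Mathlib.NumberTheory.Padics.Complex
import Mathlib.RingTheory.PowerSeries.Derivative
import Mathlib.Analysis.Normed.Group.Ultra
import Mathlib.Analysis.SpecificLimits.Normed
import Mathlib.Analysis.Normed.Ring.InfiniteSum
import HarnessLib

/-!
# Bounded power series over `ℂ_p` on the open unit disc: values, products, derivatives and the
# first-order ultrametric Taylor estimate (toolkit for the `λ`-descent AN-F₂, route (RIG))
# (helper file for crux 2 `GoodLatticeBDPValue`, stmt-BirchSwinnertonDyer-19032, line `halves`, stub 3
# `stub_anDS`, piece AN-F₂ `KatzLineDescentAt` of `Cruxes/GoodLatticeBDPValue/Lines/halves_anDS_split_idea11g4.lean`;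
# seat `bsd-line-x1-p1-w3` gen 2)

THE ANALYTIC STEP of the different-period rigidity (RIG) compares two CGLS-type frames `Q`, `L` of
one `θ_K` through the relation `Q(u^k − 1) = d^k · L(u^k − 1)` along the powers of one interpolation
character and derives (next file, `…KatzLineDescentODE`) the formal identity
`(1+T)·(Q·L′ − Q′·L) + a·Q·L = 0` by a first-order expansion at `x_k` along `x_{k+p^j} → x_k`.
This file is the toolkit it needs, for power series `F ∈ ℂ_p⟦T⟧` with BOUNDED coefficients
(`‖[T^n]F‖ ≤ C`) evaluated on the open unit disc `‖x‖ < 1` in the `HasSum`/`tsum` currency of the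
tree's `IntSeries.HasValueAt`:

* §1 summability and the ultrametric bound `‖F(x)‖ ≤ C` (`summable_mul_pow`, `norm_tsum_mul_pow_le`),
  multiplicativity of evaluation (`hasSum_cauchy_mul_pow`, Cauchy product of absolutely convergent
  series), the Taylor term bound `‖(x+h)^{n+1} − x^{n+1} − (n+1)x^n h‖ ≤ ‖h‖²` and the **first-order
  ultrametric Taylor estimate** `norm_taylor_sub_le`: `‖F(x+h) − F(x) − h·F′(x)‖ ≤ C‖h‖²` with
  `F′(x) = Σ (n+1)[T^{n+1}]F·x^n`;
* §2 the same in the `PowerSeries` currency: coefficient bounds for `F·G`, `T·F`, `F′`, `C a·F`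
  and the values `(F·G)(x) = F(x)G(x)`, `(T·F)(x) = x·F(x)`, `F′(x)`, `(C a·F)(x) = a·F(x)` as
  `HasSum` statements (`hasSum_coeff_mul`, `hasSum_coeff_X_mul`, `hasSum_coeff_derivative`,
  `hasSum_coeff_C_mul`);

Pure `p`-adic analysis; no fact, no definition, no `sorry`; nothing about BSD.
References: Koblitz 1984 Ch. IV §1; Washington 1997 §5.1, §7.1; Cassels 1986 Ch. 4.
-/

-- the summit namespace `Summit.BirchSwinnertonDyer.BirchSwinnertonDyer` repeats the problem name by design (D-0017)
set_option linter.dupNamespace false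
set_option autoImplicit false

noncomputable section

open scoped Classical Topology

open Filter Finset PowerSeries

namespace Summit.BirchSwinnertonDyer.BirchSwinnertonDyer.Theorems.KatzLineDescent

variable {p : ℕ} [Fact p.Prime]

/-! ## §1 Bounded power series over `ℂ_p` on the open unit disc -/

section Toolkit

variable {c : ℕ → ℂ_[p]} {C : ℝ}

/-- The general term of a bounded series at a point of the open disc is bounded by `C‖x‖^n`.
[cite: Koblitz1984, Ch. IV §1] -/
theorem norm_mul_pow_le (hc : ∀ n, ‖c n‖ ≤ C) (x : ℂ_[p]) (n : ℕ) :
    ‖c n * x ^ n‖ ≤ C * ‖x‖ ^ n := by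
  rw [norm_mul, norm_pow]
  exact mul_le_mul_of_nonneg_right (hc n) (pow_nonneg (norm_nonneg _) _)

/-- A bounded series is absolutely summable at every point of the open unit disc.
[cite: Koblitz1984, Ch. IV §1] -/
theorem summable_norm_mul_pow (hc : ∀ n, ‖c n‖ ≤ C) {x : ℂ_[p]} (hx : ‖x‖ < 1) :
    Summable (fun n ↦ ‖c n * x ^ n‖) :=
  Summable.of_nonneg_of_le (fun _ ↦ norm_nonneg _) (norm_mul_pow_le hc x)
    ((summable_geometric_of_lt_one (norm_nonneg _) hx).mul_left C)

/-- A bounded series is summable at every point of the open unit disc. [cite: Koblitz1984, Ch. IV §1] -/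
theorem summable_mul_pow (hc : ∀ n, ‖c n‖ ≤ C) {x : ℂ_[p]} (hx : ‖x‖ < 1) :
    Summable (fun n ↦ c n * x ^ n) :=
  (summable_norm_mul_pow hc hx).of_norm

/-- **Ultrametric bound on values**: `‖Σ c_n x^n‖ ≤ C` for `‖x‖ < 1`, `‖c_n‖ ≤ C`.
[cite: Koblitz1984, Ch. IV §1] -/
theorem norm_tsum_mul_pow_le (hc : ∀ n, ‖c n‖ ≤ C) {x : ℂ_[p]} (hx : ‖x‖ < 1) :
    ‖∑' n, c n * x ^ n‖ ≤ C := by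
  have hC : 0 ≤ C := (norm_nonneg _).trans (hc 0)
  refine IsUltrametricDist.norm_tsum_le_of_forall_le_of_nonneg hC fun n ↦ (norm_mul_pow_le hc x n).trans ?_
  exact mul_le_of_le_one_right hC (pow_le_one₀ (norm_nonneg _) hx.le)

/-- `‖n + 1‖ ≤ 1` in `ℂ_p` (an integer). [cite: Washington1997, §5.1] -/
theorem norm_natCast_add_one_le_one (n : ℕ) : ‖(n : ℂ_[p]) + 1‖ ≤ 1 := by
  have h : (n : ℂ_[p]) + 1 = algebraMap ℚ_[p] ℂ_[p] ((n + 1 : ℤ) : ℚ_[p]) := by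
    rw [map_intCast]; push_cast; rfl
  rw [h, norm_algebraMap']
  exact Padic.norm_int_le_one _

/-- The coefficients `(n+1)·c_{n+1}` of the formal derivative are bounded by the same constant.
[cite: Washington1997, §7.1] -/
theorem norm_deriv_coeff_le (hc : ∀ n, ‖c n‖ ≤ C) (n : ℕ) : ‖c (n + 1) * (n + 1)‖ ≤ C := by
  have hC : 0 ≤ C := (norm_nonneg _).trans (hc 0)
  rw [norm_mul]
  exact (mul_le_mul (hc _) (norm_natCast_add_one_le_one n) (norm_nonneg _) hC).trans (mul_one C).le

/-- **Evaluation is multiplicative** on the open unit disc: the Cauchy product of two bounded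
series sums to the product of the values. [cite: Koblitz1984, Ch. IV §1] -/
theorem hasSum_cauchy_mul_pow {c c' : ℕ → ℂ_[p]} {C C' : ℝ} (hc : ∀ n, ‖c n‖ ≤ C)
    (hc' : ∀ n, ‖c' n‖ ≤ C') {x : ℂ_[p]} (hx : ‖x‖ < 1) :
    HasSum (fun n ↦ (∑ ij ∈ antidiagonal n, c ij.1 * c' ij.2) * x ^ n)
      ((∑' n, c n * x ^ n) * ∑' n, c' n * x ^ n) := by
  have h1 := summable_norm_mul_pow hc hx
  have h2 := summable_norm_mul_pow hc' hx
  have hprod := tsum_mul_tsum_eq_tsum_sum_antidiagonal_of_summable_norm h1 h2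
  have hS := summable_sum_mul_antidiagonal_of_summable_norm' h1 (summable_mul_pow hc hx) h2
    (summable_mul_pow hc' hx)
  have key : ∀ n, ∑ ij ∈ antidiagonal n, c ij.1 * x ^ ij.1 * (c' ij.2 * x ^ ij.2) =
      (∑ ij ∈ antidiagonal n, c ij.1 * c' ij.2) * x ^ n := by
    intro n
    rw [sum_mul]
    refine sum_congr rfl fun ij hij ↦ ?_
    rw [HasAntidiagonal.mem_antidiagonal] at hij
    rw [← hij, pow_add]; ring
  have h := hS.hasSum
  rw [← hprod] at h
  simpa only [key] using h

/-- The Taylor remainder term `(x+h)^{n+1} − x^{n+1} − (n+1)x^n h` has norm `≤ ‖h‖²` on the closed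
unit disc (ultrametric induction on `n` via `E_{n+1} = (x+h)E_n + (n+1)x^n h²`).
[cite: Koblitz1984, Ch. IV §1] -/
theorem norm_taylorTerm_le {x h : ℂ_[p]} (hx : ‖x‖ ≤ 1) (hh : ‖h‖ ≤ 1) (n : ℕ) :
    ‖(x + h) ^ (n + 1) - x ^ (n + 1) - (n + 1) * x ^ n * h‖ ≤ ‖h‖ ^ 2 := by
  induction n with
  | zero => simp
  | succ n ih =>
    have hrec : (x + h) ^ (n + 1 + 1) - x ^ (n + 1 + 1) - ((n + 1 : ℕ) + 1 : ℂ_[p]) * x ^ (n + 1) * h =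
        (x + h) * ((x + h) ^ (n + 1) - x ^ (n + 1) - (n + 1) * x ^ n * h) +
          ((n : ℂ_[p]) + 1) * x ^ n * h ^ 2 := by
      push_cast; ring
    rw [Nat.cast_succ] at hrec ⊢
    rw [hrec]
    refine (IsUltrametricDist.norm_add_le_max _ _).trans (max_le ?_ ?_)
    · rw [norm_mul]
      have hxh : ‖x + h‖ ≤ 1 := (IsUltrametricDist.norm_add_le_max _ _).trans (max_le hx hh)
      calc ‖x + h‖ * ‖(x + h) ^ (n + 1) - x ^ (n + 1) - (↑n + 1) * x ^ n * h‖
          ≤ 1 * ‖h‖ ^ 2 := mul_le_mul hxh ih (norm_nonneg _) zero_le_one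
        _ = ‖h‖ ^ 2 := one_mul _
    · rw [norm_mul, norm_mul, norm_pow, norm_pow]
      have h1 : ‖((n : ℂ_[p]) + 1)‖ ≤ 1 := norm_natCast_add_one_le_one n
      calc ‖(n : ℂ_[p]) + 1‖ * ‖x‖ ^ n * ‖h‖ ^ 2 ≤ 1 * 1 * ‖h‖ ^ 2 := by
            gcongr
            exact pow_le_one₀ (norm_nonneg _) hx
        _ = ‖h‖ ^ 2 := by ring

/-- **First-order ultrametric Taylor estimate.** For a bounded series `F = Σ c_n T^n` (`‖c_n‖ ≤ C`)
and `x`, `h` in the open unit disc: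
`‖F(x+h) − F(x) − h·F′(x)‖ ≤ C·‖h‖²`, where `F′(x) = Σ (n+1)c_{n+1}x^n`. [cite: Koblitz1984, Ch. IV §1]
[cite: Washington1997, §7.1] -/
theorem norm_taylor_sub_le (hc : ∀ n, ‖c n‖ ≤ C) {x h : ℂ_[p]} (hx : ‖x‖ < 1) (hh : ‖h‖ < 1) :
    ‖(∑' n, c n * (x + h) ^ n) - (∑' n, c n * x ^ n) - h * ∑' n, c (n + 1) * (n + 1) * x ^ n‖ ≤
      C * ‖h‖ ^ 2 := by
  have hC : 0 ≤ C := (norm_nonneg _).trans (hc 0)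
  have hxh : ‖x + h‖ < 1 := lt_of_le_of_lt (IsUltrametricDist.norm_add_le_max _ _) (max_lt hx hh)
  -- the three summable families, the first two with their `n = 0` term split off
  have hs1 : Summable (fun n : ℕ ↦ c (n + 1) * (x + h) ^ (n + 1)) := by
    have key := summable_mul_pow hc hxh
    rw [← summable_nat_add_iff 1] at key
    exact key
  have hs2 : Summable (fun n : ℕ ↦ c (n + 1) * x ^ (n + 1)) := by
    have key := summable_mul_pow hc hx
    rw [← summable_nat_add_iff 1] at key
    exact key
  have hd : ∀ n, ‖c (n + 1) * (n + 1)‖ ≤ C := norm_deriv_coeff_le hc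
  have hs3' : Summable (fun n : ℕ ↦ c (n + 1) * (n + 1) * x ^ n) := by
    have key := summable_mul_pow (c := fun n : ℕ ↦ c (n + 1) * ((n : ℂ_[p]) + 1)) hd hx
    beta_reduce at key
    exact key
  have hs3 : Summable (fun n : ℕ ↦ h * (c (n + 1) * (n + 1) * x ^ n)) := hs3'.mul_left h
  have e1 : ∑' n, c n * (x + h) ^ n = c 0 + ∑' n, c (n + 1) * (x + h) ^ (n + 1) := by
    rw [(summable_mul_pow hc hxh).tsum_eq_zero_add, pow_zero, mul_one]
  have e2 : ∑' n, c n * x ^ n = c 0 + ∑' n, c (n + 1) * x ^ (n + 1) := by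
    rw [(summable_mul_pow hc hx).tsum_eq_zero_add, pow_zero, mul_one]
  have e3 : h * ∑' n, c (n + 1) * (n + 1) * x ^ n = ∑' n, h * (c (n + 1) * (n + 1) * x ^ n) :=
    hs3'.tsum_mul_left h |>.symm
  -- combine into one series of Taylor terms
  have e4 : (∑' n, c (n + 1) * (x + h) ^ (n + 1)) - (∑' n, c (n + 1) * x ^ (n + 1)) -
      (∑' n, h * (c (n + 1) * (n + 1) * x ^ n)) =
      ∑' n, c (n + 1) * ((x + h) ^ (n + 1) - x ^ (n + 1) - (n + 1) * x ^ n * h) := by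
    rw [← hs1.tsum_sub hs2, ← (hs1.sub hs2).tsum_sub hs3]
    refine tsum_congr fun n ↦ ?_
    ring
  have e5 : (∑' n, c n * (x + h) ^ n) - (∑' n, c n * x ^ n) - h * ∑' n, c (n + 1) * (n + 1) * x ^ n =
      ∑' n, c (n + 1) * ((x + h) ^ (n + 1) - x ^ (n + 1) - (n + 1) * x ^ n * h) := by
    rw [e1, e2, e3, ← e4]; ring
  rw [e5]
  refine IsUltrametricDist.norm_tsum_le_of_forall_le_of_nonneg (mul_nonneg hC (sq_nonneg _)) fun n ↦ ?_
  rw [norm_mul]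
  exact mul_le_mul (hc _) (norm_taylorTerm_le hx.le hh.le n) (norm_nonneg _) hC

end Toolkit

/-! ## §2 The `PowerSeries` currency: coefficient bounds and values of `F·G`, `T·F`, `F′`, `C a·F` -/

section Series

variable {F G : PowerSeries ℂ_[p]} {C C' : ℝ}

/-- Coefficients of a product of bounded series are bounded by the product of the bounds
(ultrametric inequality on `Σ_{i+j=n} [T^i]F·[T^j]G`). [cite: Koblitz1984, Ch. IV §1] -/
theorem norm_coeff_mul_le (hF : ∀ n, ‖coeff n F‖ ≤ C) (hG : ∀ n, ‖coeff n G‖ ≤ C') (n : ℕ) :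
    ‖coeff n (F * G)‖ ≤ C * C' := by
  have hC : 0 ≤ C := (norm_nonneg _).trans (hF 0)
  have hC' : 0 ≤ C' := (norm_nonneg _).trans (hG 0)
  rw [coeff_mul]
  refine IsUltrametricDist.norm_sum_le_of_forall_le_of_nonneg (mul_nonneg hC hC') fun ij _ ↦ ?_
  rw [norm_mul]
  exact mul_le_mul (hF _) (hG _) (norm_nonneg _) hC

/-- Coefficients of `T·F` are bounded by the bound of `F`. [cite: Koblitz1984, Ch. IV §1] -/
theorem norm_coeff_X_mul_le (hF : ∀ n, ‖coeff n F‖ ≤ C) (n : ℕ) : ‖coeff n (X * F)‖ ≤ C := by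
  have hC : 0 ≤ C := (norm_nonneg _).trans (hF 0)
  rcases n with _ | n
  · rw [coeff_zero_X_mul, norm_zero]; exact hC
  · rw [coeff_succ_X_mul]; exact hF n

/-- Coefficients of the formal derivative `F′` are bounded by the bound of `F` (`‖n+1‖ ≤ 1`).
[cite: Washington1997, §7.1] -/
theorem norm_coeff_derivative_le (hF : ∀ n, ‖coeff n F‖ ≤ C) (n : ℕ) :
    ‖coeff n (d⁄dX ℂ_[p] F)‖ ≤ C := by
  rw [coeff_derivative]
  exact norm_deriv_coeff_le hF n

/-- Coefficients of `C a · F` are bounded by `‖a‖·C`. [cite: Koblitz1984, Ch. IV §1] -/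
theorem norm_coeff_C_mul_le (hF : ∀ n, ‖coeff n F‖ ≤ C) (a : ℂ_[p]) (n : ℕ) :
    ‖coeff n (PowerSeries.C a * F)‖ ≤ ‖a‖ * C := by
  rw [coeff_C_mul, norm_mul]
  exact mul_le_mul_of_nonneg_left (hF n) (norm_nonneg a)

/-- Coefficients of `F + G` / `F − G` are bounded by the max of the bounds. [cite: Koblitz1984, Ch. IV §1] -/
theorem norm_coeff_sub_le (hF : ∀ n, ‖coeff n F‖ ≤ C) (hG : ∀ n, ‖coeff n G‖ ≤ C') (n : ℕ) :
    ‖coeff n (F - G)‖ ≤ max C C' := by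
  rw [map_sub]
  calc ‖coeff n F - coeff n G‖ = ‖coeff n F + -coeff n G‖ := by rw [sub_eq_add_neg]
    _ ≤ max ‖coeff n F‖ ‖-coeff n G‖ := IsUltrametricDist.norm_add_le_max _ _
    _ ≤ max C C' := by rw [norm_neg]; exact max_le_max (hF n) (hG n)

/-- Coefficients of `F + G` are bounded by the max of the bounds. [cite: Koblitz1984, Ch. IV §1] -/
theorem norm_coeff_add_le (hF : ∀ n, ‖coeff n F‖ ≤ C) (hG : ∀ n, ‖coeff n G‖ ≤ C') (n : ℕ) :
    ‖coeff n (F + G)‖ ≤ max C C' := by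
  rw [map_add]
  exact (IsUltrametricDist.norm_add_le_max _ _).trans (max_le_max (hF n) (hG n))

variable {x : ℂ_[p]}

/-- **The value of a bounded series** at a point of the open disc, as a `HasSum`.
[cite: Koblitz1984, Ch. IV §1] -/
theorem hasSum_coeff (hF : ∀ n, ‖coeff n F‖ ≤ C) (hx : ‖x‖ < 1) :
    HasSum (fun n ↦ coeff n F * x ^ n) (∑' n, coeff n F * x ^ n) :=
  (summable_mul_pow hF hx).hasSum

/-- **Value of a product** `(F·G)(x) = F(x)·G(x)`. [cite: Koblitz1984, Ch. IV §1] -/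
theorem hasSum_coeff_mul (hF : ∀ n, ‖coeff n F‖ ≤ C) (hG : ∀ n, ‖coeff n G‖ ≤ C') (hx : ‖x‖ < 1) :
    HasSum (fun n ↦ coeff n (F * G) * x ^ n)
      ((∑' n, coeff n F * x ^ n) * ∑' n, coeff n G * x ^ n) := by
  have h := hasSum_cauchy_mul_pow hF hG hx
  refine h.congr_fun fun n ↦ ?_
  rw [coeff_mul]

/-- **Value of `T·F`**: `(T·F)(x) = x·F(x)`. [cite: Koblitz1984, Ch. IV §1] -/
theorem hasSum_coeff_X_mul (hF : ∀ n, ‖coeff n F‖ ≤ C) (hx : ‖x‖ < 1) :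
    HasSum (fun n ↦ coeff n (X * F) * x ^ n) (x * ∑' n, coeff n F * x ^ n) := by
  have h := ((summable_mul_pow hF hx).hasSum.mul_left x)
  -- shift the index by one: the `n = 0` term of `T·F` vanishes
  have h' : HasSum (fun n ↦ coeff (n + 1) (X * F) * x ^ (n + 1)) (x * ∑' n, coeff n F * x ^ n) := by
    refine h.congr_fun fun n ↦ ?_
    rw [coeff_succ_X_mul, pow_succ]; ring
  have h0 : HasSum (fun n ↦ coeff n (X * F) * x ^ n) (coeff 0 (X * F) * x ^ 0 +
      x * ∑' n, coeff n F * x ^ n) := by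
    exact (hasSum_nat_add_iff' 1).mp (by simpa [Finset.sum_range_one] using h')
  simpa [coeff_zero_X_mul] using h0

/-- **Value of the formal derivative**: `F′(x) = Σ (n+1)[T^{n+1}]F·x^n`. [cite: Washington1997, §7.1] -/
theorem hasSum_coeff_derivative (hF : ∀ n, ‖coeff n F‖ ≤ C) (hx : ‖x‖ < 1) :
    HasSum (fun n ↦ coeff n (d⁄dX ℂ_[p] F) * x ^ n) (∑' n, coeff (n + 1) F * (n + 1) * x ^ n) := by
  have hs : Summable (fun n : ℕ ↦ coeff (n + 1) F * ((n : ℂ_[p]) + 1) * x ^ n) := by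
    have key := summable_mul_pow (c := fun n : ℕ ↦ coeff (n + 1) F * ((n : ℂ_[p]) + 1))
      (norm_deriv_coeff_le hF) hx
    beta_reduce at key
    exact key
  refine hs.hasSum.congr_fun fun n ↦ ?_
  rw [coeff_derivative]

/-- **Value of `C a · F`**: `a·F(x)`. [cite: Koblitz1984, Ch. IV §1] -/
theorem hasSum_coeff_C_mul (hF : ∀ n, ‖coeff n F‖ ≤ C) (hx : ‖x‖ < 1) (a : ℂ_[p]) :
    HasSum (fun n ↦ coeff n (PowerSeries.C a * F) * x ^ n) (a * ∑' n, coeff n F * x ^ n) := by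
  refine ((summable_mul_pow hF hx).hasSum.mul_left a).congr_fun fun n ↦ ?_
  rw [coeff_C_mul, mul_assoc]

end Series

end Summit.BirchSwinnertonDyer.BirchSwinnertonDyer.Theorems.KatzLineDescent

end
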